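import Summits.NavierStokesRegularity.NavierStokesRegularity.Theorems.LevelSetModerationHighSpeedPressureWorkSketchTransfer
import HarnessLib

/-!
# Line `Sketch` (idea `comoving-head-ceiling`) — skeleton of the crux `HighSpeedPressureWork`
# (route LevelSetModeration, item stmt-NavierStokesRegularity-18149)

The crux: for every `ν, T > 0` there are `m < 10/3` and a modulus `F` such that every classical
Leray–Hopf solution on `ℝ³ × [0,T)` from a rapidly decaying datum with `∫|u₀|² ≤ E₀`, `|u₀| ≤ B₀`
satisfies, for `M ≥ 2B₀`, `c ∈ [M/2, M]`, `t < T`,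
`PW_c(t) := −∫₀ᵗ∫ (1−c/|u|)₊ ∇p̃·u ≤ √(F(E₀,B₀) M^m V_c(T)) · √(D_c(T))`,
`V_c(T) = ∫₀ᵀ |{|u|>c}|`, `D_c(T) = ∫₀ᵀ∫ 1_{|u|>c} |∇|u||²`.

LINE (card `Ideas/comoving-head-ceiling.md`, reconstructed by the lead; the planner's `Sketch.lean`
lives in the evidence store, not mounted in this jail). Write `s = |u|`, `A = {s > c}`,
`H_U = p + |u − U|²/2` (Bernoulli head in the Galilean frame `U`, with the GIVEN pressure `p`:
every step below is invariant under `p ↦ p + C(τ)`).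

* `stub_pressureWorkGivenPressure` (S): `∇p̃ = ∇p` for a.e. time (`tao_pressure_normalisation_holds`),
  so `PW_c` may be computed with the given smooth pressure.
* `stub_sliceRegularity` (M/L, Tao class): on every closed slab `[0,t]`, `t < T`, the level sets
  `{|u(τ)| > c}` are bounded, `u` and `H_U` are bounded above, and the two slice functionals of the
  line are integrable in time (`tao2011_hasBoundedSobolevNormsOn_holds` + Sobolev embedding +
  `abs_normalisedPressure_le`).
* `stub_levelSetIBP` (L, pure calculus): `−∫ (1−c/s)₊ ∇q·v = ∫_A (c/s²)(v·∇s) q` for a `C¹`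
  divergence-free `v` with bounded `A` and `C¹` `q` (the kink of `(1−c/s)₊` at `s = c` is removed by
  the cut-offs of `LevelSetModerationModerationIdentity.lean`).
* `stub_moderatedSplit` (M, calculus + the PROVED `ModerationIdentity`): subtract the free moderator
  `k − s²/2 − |U|²/2`, use the ceiling `H_U ≤ k` on `A` and `|(c/s²)(v·∇s)⟨v,U⟩| ≤ c|U||∇s|`:
  `∫_A (c/s²)(v·∇s) q ≤ ∫_A (c/s²)(v·∇s)₋ (k − H_U) + c|U| ∫_A |∇s|`.
* `stub_headCeiling` (L, drift–heat maximum principle on `ℝ³`):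
  `(∂ₜ + u·∇ − νΔ) H_U = ∂ₜp + U·∇p − ν|ω|²` (pressure Poisson, landed as
  `BlobRiccatiClosure.Sketch.stub_pressureLaplacian`), hence
  `H_U(τ) ≤ sup H_U(0) + ∫₀^τ r` whenever `∂ₜp + U·∇p ≤ r(τ)` pointwise (`r` continuous, any sign).
* `stub_costCauchySchwarz` (M, measure theory): `∫₀ᵗ∫_A |∇s| ≤ √V_c(T) √D_c(T)` (finiteness of
  `V_c`, `D_c` from the Leray–Hopf inequality; junk-safe).
* `stub_comovingBudget` (OPEN — the line's new mathematics, card S3 ∧ S4): a frame `U` with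
  `c|U| ≤ ½√(F₁ M^m)`, a head level `K ≥ sup H_U(0)` and a continuous tendency majorant `r` whose
  head-DEFICIT integral `∫₀ᵗ∫_A (c/s²)(u·∇s)₋ (K + ∫₀^τ r − H_U)` is `≤ ½√(F₁ M^m V_c(T)) √D_c(T)`,
  `m < 10/3`.
* `HighSpeedPressureWork_of`: the crux BY NAME from the seven stubs (real proof: time integration of
  the slice inequalities, `integral_undef` for the Bochner junk case, `√(aV) = √a √V`).
-/

set_option linter.dupNamespace false

noncomputable section

open MeasureTheory Set Filter Topology
open scoped ENNReal

namespace Summit.NavierStokesRegularity.NavierStokesRegularity.Cruxes.HighSpeedPressureWork.Sketch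

open Literature.Analysis.FluidPDE
open Summit.NavierStokesRegularity.NavierStokesRegularity.Theses.LevelSetModeration

/-! ### Landed stubs (integration, 2026-08-17T07:40Z)
Six of the seven registered stubs are THEOREMS of the tree (namespace
`Summit.NavierStokesRegularity.NavierStokesRegularity.Theorems`, landed `--supports` this item by the
route's item-prover seat while this lead's workers proved the same statements independently):
`stub_pressureWorkGivenPressure` (p145388, …GivenPressure.lean), `stub_levelSetIBP` (p145227,
…LevelSetIBP.lean), `stub_moderatedSplit` (p145425, …ModeratedSplit.lean), `stub_headCeiling` (p146511,
…HeadCeiling.lean), `stub_sliceRegularity` (…SliceRegularity.lean), `stub_costCauchySchwarz`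
(…CostCauchySchwarz.lean); and the composition below is landed verbatim as the TRANSFER
`levelSetModeration_highSpeedPressureWork_of_comovingBudget` (p146705, …SketchTransfer.lean).
The skeleton is therefore closed modulo the single stub `stub_comovingBudget` — which is FALSE on the
class as typed (nested-shell pressure depression at bounded amplification, `Lines/Sketch.dead.md`,
idea `nested-shell-depression`): the line is dead at this stub. -/

/-- **STUB 6 (OPEN — the line's new mathematics; card S3 "rise budget" ∧ S4 "deficit flux").**
For every `ν, T > 0` there are `m < 10/3` and a modulus `F₁ ≥ 0` such that for every classical
Leray–Hopf solution from a rapidly decaying datum with `∫|u₀|² ≤ E₀`, `|u₀| ≤ B₀`, and all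
`M ≥ 2B₀`, `c ∈ [M/2,M]`, `t < T`, there are a Galilean frame `U` within the budget
`c|U| ≤ ½√(F₁ M^m)`, a head level `K ≥ sup (p(0) + |u(0)−U|²/2)` and a continuous majorant `r` of
the co-moving pressure tendency `∂ₜp + U·∇p` on `[0,t] × ℝ³`, for which the head-DEFICIT flux
through the decelerating part of the high-speed set obeys
`∫₀ᵗ∫ 1_{|u|>c} (c/|u|²)(u·∇|u|)₋ (K + ∫₀^τ r − p − |u−U|²/2) ≤ ½ √(F₁ M^m V_c(T)) √(D_c(T))`.
Gauge-invariant under `p ↦ p + C(τ)`. Honest size: with stubs 1–5, 7 this implies the crux; the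
card rates it blow-up-exclusion strength. -/
theorem stub_comovingBudget :
    ∀ (ν T : ℝ), 0 < ν → 0 < T → ∃ m : ℝ, m < 10 / 3 ∧ ∃ F₁ : ℝ → ℝ → ℝ,
      ∀ (u : ℝ → EuclideanSpace ℝ (Fin 3) → EuclideanSpace ℝ (Fin 3))
        (p : ℝ → EuclideanSpace ℝ (Fin 3) → ℝ),
        Literature.Analysis.FluidPDE.IsClassicalNSSolutionOn (Set.Ico 0 T) ν 0 u p →
        Literature.Analysis.FluidPDE.IsLerayHopfOn T ν 0 (u 0) u →
        Literature.Analysis.FluidPDE.HasRapidSpatialDecay (u 0) →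
        ∀ (E₀ B₀ : ℝ), (∫ x, ‖u 0 x‖ ^ 2) ≤ E₀ → (∀ x, ‖u 0 x‖ ≤ B₀) →
        ∀ (M c t : ℝ), 2 * B₀ ≤ M → M / 2 ≤ c → c ≤ M → 0 < c → t ∈ Set.Ico 0 T →
        ∃ (U : EuclideanSpace ℝ (Fin 3)) (K : ℝ) (r : ℝ → ℝ),
          Continuous r ∧ 0 ≤ F₁ E₀ B₀ ∧
          (∀ x, p 0 x + ‖u 0 x - U‖ ^ 2 / 2 ≤ K) ∧
          (∀ τ ∈ Set.Icc 0 t, ∀ x,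
            Literature.Analysis.FluidPDE.timeDerivWithin (Set.Ico 0 T) p τ x + fderiv ℝ (p τ) x U
              ≤ r τ) ∧
          c * ‖U‖ ≤ Real.sqrt (F₁ E₀ B₀ * M ^ m) / 2 ∧
          (∫ τ in Set.Ioo 0 t, ∫ x, Set.indicator {x | c < ‖u τ x‖}
              (fun x => c / ‖u τ x‖ ^ 2 * max (-(fderiv ℝ (fun y => ‖u τ y‖) x (u τ x))) 0 *
                (K + (∫ σ in Set.Ioo 0 τ, r σ) - (p τ x + ‖u τ x - U‖ ^ 2 / 2))) x) ≤
            Real.sqrt (F₁ E₀ B₀ * M ^ m *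
                (∫⁻ τ in Set.Ioo 0 T, volume {x | c < ‖u τ x‖}).toReal) / 2 *
              Real.sqrt ((∫⁻ τ in Set.Ioo 0 T, ∫⁻ x, Set.indicator {x | c < ‖u τ x‖}
                (fun x => ENNReal.ofReal (‖fderiv ℝ (fun y => ‖u τ y‖) x‖ ^ 2)) x).toReal) := by
  sorry

/-- **The crux BY NAME from the stubs** — after integration: the landed transfer applied to the one
remaining (dead) stub. -/
theorem HighSpeedPressureWork_of :
    Summit.NavierStokesRegularity.NavierStokesRegularity.Theses.LevelSetModeration.HighSpeedPressureWork :=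
  Summit.NavierStokesRegularity.NavierStokesRegularity.Theorems.levelSetModeration_highSpeedPressureWork_of_comovingBudget
    stub_comovingBudget

end Summit.NavierStokesRegularity.NavierStokesRegularity.Cruxes.HighSpeedPressureWork.Sketch

end
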